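import Literature.NumberTheory.EllipticCurves.EtaQuotientQExpansionProofs
import Mathlib.NumberTheory.Padics.RingHoms
import HarnessLib

/-!
# `3ℕ`-supported power series and the «`q³ ↦ q`» contraction (lemmas for E-an-56 `EtaUnitCubeIffThree`)

Summit `BirchSwinnertonDyer`, route `ManinLocalTwoThree` (cell bsd-f2-manin), crux C3 `ManinPrimeToThreeAtNine`
(stmt-BirchSwinnertonDyer-22968), the `W[3]`-REDUCIBLE residual (E-es-20 / the an lens's cuspidal-Kummer CUBE certificate
E-an-55/57/58, MEMO-an §56.12); support theorem **E-an-56 `EtaUnitCubeIffThree`** (`Summits/BirchSwinnertonDyer/Rank1Residual/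
ManinAdditive/CuspidalKummerClass.lean`, typer T-an-18; REF1 §R50: «TRUE, elementary»), the `p = 3` twin of E-an-49⁺
`EtaUnitSquareIffEven` (proved in `…EtaUnitSquare{Odd,Half,IffEven}.lean`).  This file is the `p = 3` analogue of
`…EtaUnitSquareHalf.lean`: plumbing over a commutative ring `R`, no new definitions (the contraction `F(q³) ↦ F` is written
`PowerSeries.mk fun m => coeff (3*m) f` in place; «`3ℕ`-supported» is `∀ i, ¬ 3 ∣ i → coeff i f = 0`):

* `coeff_mul_of_vanishThreeBelow` — for series whose coefficients vanish in degrees `< δ₀` prime to `3` (`3 ∤ δ₀`), the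
  `δ₀`-th coefficient of a product is `f_{δ₀} g₀ + f₀ g_{δ₀}` and the vanishing persists (the additive functional of §56.3);
* `vanishThree_mul/pow/prod/map` — `3ℕ`-supported series are closed under products;
* `contractThree_mul/one/pow/prod/map` — on such series the contraction `q³ ↦ q` is multiplicative and commutes with `map`;
* `vanishThree_of_mul_eq` — if `Φ·A = B` with `A`, `B` `3ℕ`-supported and `A(0) = 1`, then `Φ` is `3ℕ`-supported;
* `vanishThree_of_cube_vanishThree` — over a domain of characteristic `0`: if `H³` is `3ℕ`-supported and `H(0) ≠ 0` then so
  is `H` (uniqueness of the cube root: the least offending coefficient `H_m` gives `(H³)_m = 3 H₀² H_m ≠ 0`), whence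
  `isCube_contractThree_of_isCube`;
* `vanishThree_formalEulerScaled_of_three_dvd`, `contractThree_formalEulerScaled_three_mul` — `E(q^{3δ})` contracts to `E(q^δ)`.

Nothing about BSD or Manin's conjecture is proved here.

References: cell memo HOME/MEMO-an.md §56.3, §56.12; T. M. Apostol, GTM 41 §3.1–§3.2 [cite: Apostol1990, §3.1–§3.2].
-/

set_option autoImplicit false
set_option linter.dupNamespace false

open PowerSeries Literature.NumberTheory.EllipticCurves.ModularForms

namespace Summit.BirchSwinnertonDyer.BirchSwinnertonDyer.Theorems.ManinLocalTwoThree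

noncomputable section

section General

variable {R : Type*} [CommRing R]

/-- If `i + j = n` with `3 ∤ n` then `3 ∤ i` or `3 ∤ j` (plumbing). [folklore] -/
theorem not_three_dvd_or_of_add_eq {i j n : ℕ} (h : i + j = n) (hn : ¬ 3 ∣ n) : ¬ 3 ∣ i ∨ ¬ 3 ∣ j := by
  by_contra hc
  push Not at hc
  exact hn (h ▸ dvd_add hc.1 hc.2)

/-- **The additive functional.**  For `3 ∤ δ₀` and series `f`, `g` whose coefficients vanish in the degrees `< δ₀` prime to
`3`: the product has the same vanishing, and `coeff δ₀ (f g) = coeff δ₀ f · g(0) + f(0) · coeff δ₀ g`. [folklore] -/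
theorem coeff_mul_of_vanishThreeBelow {δ₀ : ℕ} (hδ₀ : ¬ 3 ∣ δ₀) {f g : PowerSeries R}
    (hf : ∀ i, ¬ 3 ∣ i → i < δ₀ → coeff i f = 0) (hg : ∀ i, ¬ 3 ∣ i → i < δ₀ → coeff i g = 0) :
    (∀ i, ¬ 3 ∣ i → i < δ₀ → coeff i (f * g) = 0) ∧
      coeff δ₀ (f * g) = coeff δ₀ f * constantCoeff g + constantCoeff f * coeff δ₀ g := by
  have hδ0 : 0 < δ₀ := Nat.pos_of_ne_zero fun h => hδ₀ (h ▸ dvd_zero 3)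
  refine ⟨?_, ?_⟩
  · intro i hi hiδ
    rw [coeff_mul]
    refine Finset.sum_eq_zero fun p hp => ?_
    rw [Finset.mem_antidiagonal] at hp
    rcases not_three_dvd_or_of_add_eq hp hi with h1 | h2
    · rw [hf p.1 h1 (by omega), zero_mul]
    · rw [hg p.2 h2 (by omega), mul_zero]
  · rw [coeff_mul]
    rw [Finset.sum_eq_add_of_mem (⟨δ₀, 0⟩ : ℕ × ℕ) (⟨0, δ₀⟩ : ℕ × ℕ) (by simp) (by simp)
      (by intro h; have := congrArg Prod.fst h; simp at this; omega)]
    · simp only [coeff_zero_eq_constantCoeff]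
    · intro p hp hpne
      obtain ⟨hp1, hp2⟩ := hpne
      rw [Finset.mem_antidiagonal] at hp
      rcases not_three_dvd_or_of_add_eq hp hδ₀ with h1 | h2
      · -- `3 ∤ p.1`; `p.1 < δ₀` unless `p = (δ₀, 0)`
        have hlt : p.1 < δ₀ := by
          rcases Nat.lt_or_ge p.1 δ₀ with h | h
          · exact h
          · exfalso; apply hp1; exact Prod.ext (by simp; omega) (by simp; omega)
        rw [hf p.1 h1 hlt, zero_mul]
      · have hlt : p.2 < δ₀ := by
          rcases Nat.lt_or_ge p.2 δ₀ with h | h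
          · exact h
          · exfalso; apply hp2; exact Prod.ext (by simp; omega) (by simp; omega)
        rw [hg p.2 h2 hlt, mul_zero]

/-- Powers: `f^n` keeps the vanishing below `δ₀` and, when `f(0) = 1`, `coeff δ₀ (f^n) = n • coeff δ₀ f`. [folklore] -/
theorem coeff_pow_of_vanishThreeBelow {δ₀ : ℕ} (hδ₀ : ¬ 3 ∣ δ₀) {f : PowerSeries R}
    (hf0 : constantCoeff f = 1) (hf : ∀ i, ¬ 3 ∣ i → i < δ₀ → coeff i f = 0) (n : ℕ) :
    constantCoeff (f ^ n) = 1 ∧ (∀ i, ¬ 3 ∣ i → i < δ₀ → coeff i (f ^ n) = 0) ∧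
      coeff δ₀ (f ^ n) = n • coeff δ₀ f := by
  have hδne : δ₀ ≠ 0 := fun h => hδ₀ (h ▸ dvd_zero 3)
  induction n with
  | zero =>
    refine ⟨by simp, ?_, ?_⟩
    · intro i hi _
      rw [pow_zero, coeff_one, if_neg]; exact fun h => hi (h ▸ dvd_zero 3)
    · rw [pow_zero, coeff_one, if_neg hδne, zero_smul]
  | succ n ih =>
    obtain ⟨h0, hA, hc⟩ := ih
    obtain ⟨hA', hc'⟩ := coeff_mul_of_vanishThreeBelow hδ₀ hA hf
    refine ⟨by rw [pow_succ, map_mul, h0, hf0, mul_one], by rw [pow_succ]; exact hA', ?_⟩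
    rw [pow_succ, hc', hc, h0, hf0, mul_one, one_mul, succ_nsmul]

/-- Finite products: the vanishing below `δ₀` is kept and, for constant terms `1`, `coeff δ₀` is additive. [folklore] -/
theorem coeff_prod_of_vanishThreeBelow {δ₀ : ℕ} (hδ₀ : ¬ 3 ∣ δ₀) {ι : Type*} (s : Finset ι) (F : ι → PowerSeries R)
    (hF0 : ∀ i ∈ s, constantCoeff (F i) = 1) (hF : ∀ i ∈ s, ∀ j, ¬ 3 ∣ j → j < δ₀ → coeff j (F i) = 0) :
    constantCoeff (∏ i ∈ s, F i) = 1 ∧ (∀ j, ¬ 3 ∣ j → j < δ₀ → coeff j (∏ i ∈ s, F i) = 0) ∧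
      coeff δ₀ (∏ i ∈ s, F i) = ∑ i ∈ s, coeff δ₀ (F i) := by
  classical
  have hδne : δ₀ ≠ 0 := fun h => hδ₀ (h ▸ dvd_zero 3)
  induction s using Finset.induction_on with
  | empty =>
    refine ⟨by simp, ?_, ?_⟩
    · intro j hj _; rw [Finset.prod_empty, coeff_one, if_neg]; exact fun h => hj (h ▸ dvd_zero 3)
    · rw [Finset.prod_empty, Finset.sum_empty, coeff_one, if_neg hδne]
  | insert a s ha ih =>
    obtain ⟨h0, hA, hc⟩ := ih (fun i hi => hF0 i (Finset.mem_insert_of_mem hi))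
      (fun i hi => hF i (Finset.mem_insert_of_mem hi))
    have ha0 := hF0 a (Finset.mem_insert_self a s)
    obtain ⟨hA', hc'⟩ := coeff_mul_of_vanishThreeBelow hδ₀ (hF a (Finset.mem_insert_self a s)) hA
    rw [Finset.prod_insert ha, Finset.sum_insert ha]
    exact ⟨by rw [map_mul, ha0, h0, mul_one], hA', by rw [hc', hc, h0, ha0, mul_one, one_mul]⟩

/-- Products of `3ℕ`-supported series are `3ℕ`-supported. [folklore] -/
theorem vanishThree_mul {f g : PowerSeries R} (hf : ∀ i, ¬ 3 ∣ i → coeff i f = 0) (hg : ∀ i, ¬ 3 ∣ i → coeff i g = 0) :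
    ∀ i, ¬ 3 ∣ i → coeff i (f * g) = 0 := by
  intro i hi
  rw [coeff_mul]
  refine Finset.sum_eq_zero fun p hp => ?_
  rw [Finset.mem_antidiagonal] at hp
  rcases not_three_dvd_or_of_add_eq hp hi with h1 | h2
  · rw [hf p.1 h1, zero_mul]
  · rw [hg p.2 h2, mul_zero]

/-- Powers of a `3ℕ`-supported series are `3ℕ`-supported. [folklore] -/
theorem vanishThree_pow {f : PowerSeries R} (hf : ∀ i, ¬ 3 ∣ i → coeff i f = 0) (n : ℕ) :
    ∀ i, ¬ 3 ∣ i → coeff i (f ^ n) = 0 := by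
  induction n with
  | zero => intro i hi; rw [pow_zero, coeff_one, if_neg]; exact fun h => hi (h ▸ dvd_zero 3)
  | succ n ih => rw [pow_succ]; exact vanishThree_mul ih hf

/-- Finite products of `3ℕ`-supported series are `3ℕ`-supported. [folklore] -/
theorem vanishThree_prod {ι : Type*} (s : Finset ι) (F : ι → PowerSeries R)
    (hF : ∀ j ∈ s, ∀ i, ¬ 3 ∣ i → coeff i (F j) = 0) : ∀ i, ¬ 3 ∣ i → coeff i (∏ j ∈ s, F j) = 0 := by
  classical
  induction s using Finset.induction_on with
  | empty => intro i hi; rw [Finset.prod_empty, coeff_one, if_neg]; exact fun h => hi (h ▸ dvd_zero 3)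
  | insert a s ha ih =>
    rw [Finset.prod_insert ha]
    exact vanishThree_mul (hF a (Finset.mem_insert_self a s)) (ih fun j hj => hF j (Finset.mem_insert_of_mem hj))

/-- **The contraction `q³ ↦ q` is multiplicative on `3ℕ`-supported series.** [folklore] -/
theorem contractThree_mul {f g : PowerSeries R} (hf : ∀ i, ¬ 3 ∣ i → coeff i f = 0) :
    (PowerSeries.mk fun m => coeff (3 * m) (f * g)) =
      (PowerSeries.mk fun m => coeff (3 * m) f) * (PowerSeries.mk fun m => coeff (3 * m) g) := by
  ext m
  simp only [coeff_mk, coeff_mul]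
  have hsub : ∑ p ∈ Finset.antidiagonal (3 * m), coeff p.1 f * coeff p.2 g =
      ∑ p ∈ (Finset.antidiagonal (3 * m)).filter (fun p => 3 ∣ p.1), coeff p.1 f * coeff p.2 g := by
    rw [Finset.sum_filter]
    refine Finset.sum_congr rfl fun p _ => ?_
    split_ifs with h
    · rfl
    · rw [hf p.1 h, zero_mul]
  have himg : (Finset.antidiagonal (3 * m)).filter (fun p => 3 ∣ p.1) =
      (Finset.antidiagonal m).image (fun q => (3 * q.1, 3 * q.2)) := by
    ext p
    simp only [Finset.mem_filter, Finset.mem_antidiagonal, Finset.mem_image, Prod.ext_iff]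
    constructor
    · rintro ⟨hsum, hdvd⟩
      exact ⟨(p.1 / 3, p.2 / 3), by omega, by omega, by omega⟩
    · rintro ⟨q, hq, h1, h2⟩
      omega
  rw [hsub, himg, Finset.sum_image]
  rintro q₁ - q₂ - h
  simp only [Prod.ext_iff] at h
  exact Prod.ext (by omega) (by omega)

/-- The contraction of `1` is `1`. [folklore] -/
theorem contractThree_one : (PowerSeries.mk fun m => coeff (3 * m) (1 : PowerSeries R)) = 1 := by
  ext m
  rw [coeff_mk, coeff_one, coeff_one]
  by_cases hm : m = 0
  · subst hm; simp
  · rw [if_neg (by omega), if_neg hm]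

/-- The contraction is multiplicative on powers of a `3ℕ`-supported series. [folklore] -/
theorem contractThree_pow {f : PowerSeries R} (hf : ∀ i, ¬ 3 ∣ i → coeff i f = 0) (n : ℕ) :
    (PowerSeries.mk fun m => coeff (3 * m) (f ^ n)) = (PowerSeries.mk fun m => coeff (3 * m) f) ^ n := by
  induction n with
  | zero => rw [pow_zero, pow_zero]; exact contractThree_one
  | succ n ih => rw [pow_succ, pow_succ, contractThree_mul (vanishThree_pow hf n), ih]

/-- The contraction is multiplicative on finite products of `3ℕ`-supported series. [folklore] -/
theorem contractThree_prod {ι : Type*} (s : Finset ι) (F : ι → PowerSeries R)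
    (hF : ∀ j ∈ s, ∀ i, ¬ 3 ∣ i → coeff i (F j) = 0) :
    (PowerSeries.mk fun m => coeff (3 * m) (∏ j ∈ s, F j)) = ∏ j ∈ s, PowerSeries.mk fun m => coeff (3 * m) (F j) := by
  classical
  induction s using Finset.induction_on with
  | empty => rw [Finset.prod_empty, Finset.prod_empty]; exact contractThree_one
  | insert a s ha ih =>
    rw [Finset.prod_insert ha, Finset.prod_insert ha, contractThree_mul (hF a (Finset.mem_insert_self a s)),
      ih fun j hj => hF j (Finset.mem_insert_of_mem hj)]

/-- The contraction commutes with coefficientwise maps. [folklore] -/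
theorem contractThree_map {S : Type*} [CommRing S] (φ : R →+* S) (f : PowerSeries R) :
    (PowerSeries.mk fun m => coeff (3 * m) (f.map φ)) = (PowerSeries.mk fun m => coeff (3 * m) f).map φ := by
  ext m
  rw [coeff_mk, coeff_map, coeff_map, coeff_mk]

/-- Coefficientwise maps preserve `3ℕ`-support. [folklore] -/
theorem vanishThree_map {S : Type*} [CommRing S] (φ : R →+* S) {f : PowerSeries R}
    (hf : ∀ i, ¬ 3 ∣ i → coeff i f = 0) : ∀ i, ¬ 3 ∣ i → coeff i (f.map φ) = 0 :=
  fun i hi => by rw [coeff_map, hf i hi, map_zero]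

/-- **If `Φ · A = B` where `A`, `B` are `3ℕ`-supported and `A(0) = 1`, then `Φ` is `3ℕ`-supported** (look at the least
degree prime to `3` carrying a non-zero coefficient of `Φ`). [folklore] -/
theorem vanishThree_of_mul_eq {Φ A B : PowerSeries R} (hA : ∀ i, ¬ 3 ∣ i → coeff i A = 0) (hA0 : constantCoeff A = 1)
    (hB : ∀ i, ¬ 3 ∣ i → coeff i B = 0) (h : Φ * A = B) : ∀ i, ¬ 3 ∣ i → coeff i Φ = 0 := by
  by_contra hne
  push Not at hne
  classical
  let m := Nat.find hne
  obtain ⟨hm3, hm_ne⟩ : ¬ 3 ∣ m ∧ coeff m Φ ≠ 0 := Nat.find_spec hne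
  have hmin : ∀ i, i < m → ¬ 3 ∣ i → coeff i Φ = 0 := fun i hi hi3 => by
    by_contra hc; exact Nat.find_min hne hi ⟨hi3, hc⟩
  obtain ⟨-, hc⟩ := coeff_mul_of_vanishThreeBelow hm3 (fun i hi3 hi => hmin i hi hi3) (fun i hi3 _ => hA i hi3)
  rw [h, hB m hm3, hA m hm3, hA0, mul_one, mul_zero, add_zero] at hc
  exact hm_ne hc.symm

/-- **Uniqueness of the cube root on `3ℕ`-supported series**: over a domain of characteristic `0`, if `H³` is
`3ℕ`-supported and `H(0) ≠ 0` then `H` is `3ℕ`-supported (the least offending `H_m` would give `(H³)_m = 3 H₀² H_m ≠ 0`).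
[folklore] -/
theorem vanishThree_of_cube_vanishThree [IsDomain R] [CharZero R] {H : PowerSeries R}
    (hH : ∀ i, ¬ 3 ∣ i → coeff i (H ^ 3) = 0) (hH0 : constantCoeff H ≠ 0) : ∀ i, ¬ 3 ∣ i → coeff i H = 0 := by
  by_contra hne
  push Not at hne
  classical
  let m := Nat.find hne
  obtain ⟨hm3, hm_ne⟩ : ¬ 3 ∣ m ∧ coeff m H ≠ 0 := Nat.find_spec hne
  have hmin : ∀ i, ¬ 3 ∣ i → i < m → coeff i H = 0 := fun i hi3 hi => by
    by_contra hc; exact Nat.find_min hne hi ⟨hi3, hc⟩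
  -- `(H²)_m = 2 H₀ H_m` and `H²` vanishes below `m` off `3ℕ`
  obtain ⟨h2A, h2c⟩ := coeff_mul_of_vanishThreeBelow hm3 hmin hmin
  -- `(H³)_m = 3 H₀² H_m`
  obtain ⟨-, h3c⟩ := coeff_mul_of_vanishThreeBelow hm3 h2A hmin
  have hcm : coeff m (H ^ 3) = 3 * (constantCoeff H * constantCoeff H * coeff m H) := by
    rw [pow_succ, pow_two, h3c, h2c, map_mul]; ring
  rw [hH m hm3] at hcm
  have h3 : (3 : R) ≠ 0 := by exact_mod_cast (show (3 : ℕ) ≠ 0 by norm_num)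
  have : (3 : R) * (constantCoeff H * constantCoeff H * coeff m H) ≠ 0 :=
    mul_ne_zero h3 (mul_ne_zero (mul_ne_zero hH0 hH0) hm_ne)
  exact this hcm.symm

/-- **A `3ℕ`-supported cube contracts to a cube** (domain of characteristic `0`, constant term `1`). [folklore] -/
theorem isCube_contractThree_of_isCube [IsDomain R] [CharZero R] {f : PowerSeries R}
    (hf : ∀ i, ¬ 3 ∣ i → coeff i f = 0) (hf0 : constantCoeff f = 1) (hcube : ∃ H : PowerSeries R, f = H ^ 3) :
    ∃ H : PowerSeries R, (PowerSeries.mk fun m => coeff (3 * m) f) = H ^ 3 := by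
  obtain ⟨H, rfl⟩ := hcube
  have hH0 : constantCoeff H ≠ 0 := by
    intro h0; rw [map_pow, h0, zero_pow three_ne_zero] at hf0; exact zero_ne_one hf0
  have hH := vanishThree_of_cube_vanishThree hf hH0
  exact ⟨PowerSeries.mk fun m => coeff (3 * m) H, contractThree_pow hH 3⟩

end General

/-! ### The Euler factors -/

section Euler

/-- `E(q^δ)` is `3ℕ`-supported for `3 ∣ δ`. [folklore] -/
theorem vanishThree_formalEulerScaled_of_three_dvd {δ : ℕ} (hδ : 3 ∣ δ) :
    ∀ i, ¬ 3 ∣ i → coeff i (formalEulerScaled δ) = 0 := by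
  intro i hi
  rw [coeff_formalEulerScaled, if_neg]
  exact fun hd => hi (hδ.trans hd)

/-- **`E(q^{3δ})` contracts to `E(q^δ)`.** [folklore] -/
theorem contractThree_formalEulerScaled_three_mul (δ : ℕ) :
    (PowerSeries.mk fun m => coeff (3 * m) (formalEulerScaled (3 * δ))) = formalEulerScaled δ := by
  ext m
  rw [coeff_mk, coeff_formalEulerScaled, coeff_formalEulerScaled]
  by_cases h : δ ∣ m
  · rw [if_pos (Nat.mul_dvd_mul_left 3 h), if_pos h, Nat.mul_div_mul_left _ _ (by norm_num)]
  · rw [if_neg, if_neg h]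
    intro h3; exact h (Nat.dvd_of_mul_dvd_mul_left (by norm_num) h3)

end Euler

end

end Summit.BirchSwinnertonDyer.BirchSwinnertonDyer.Theorems.ManinLocalTwoThree
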